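import Summits.CriticalPhenomena.PercolationContinuityZ3.Theorems.Transplant.SkelFrmBParamsFaceFloorsPinSYA
import Summits.CriticalPhenomena.PercolationContinuityZ3.Theorems.Transplant.SkelFrmBParamsFaceFloorsLAdYA
import Summits.CriticalPhenomena.PercolationContinuityZ3.Theorems.Transplant.SkelFrmBParamsFaceOriginsYLA
import Summits.CriticalPhenomena.PercolationContinuityZ3.Theorems.Transplant.SkelFrmBParamsFaceOriginsXA
import Summits.CriticalPhenomena.PercolationContinuityZ3.Theorems.Transplant.SkelFrmBParamsFaceOriginsYA
import Summits.CriticalPhenomena.PercolationContinuityZ3.Theorems.Transplant.SkelFrmBParamsFramesF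
import Summits.CriticalPhenomena.PercolationContinuityZ3.Theorems.Transplant.SkelFrmBParamsFaceFloorsClrYF
import Summits.CriticalPhenomena.PercolationContinuityZ3.Theorems.Transplant.SkelFrmBParamsFaceFloorsClrYA
import Summits.CriticalPhenomena.PercolationContinuityZ3.Theorems.Transplant.SkelFrmBParamsFaceFloorsFAYA
import Summits.CriticalPhenomena.PercolationContinuityZ3.Theorems.Transplant.SkelFrmBParamsFaceFloorsFBYA
import Summits.CriticalPhenomena.PercolationContinuityZ3.Theorems.Transplant.SkelFrmBParamsFaceFloorsFTYA
import Summits.CriticalPhenomena.PercolationContinuityZ3.Theorems.Transplant.SkelFrmBParamsFaceFloorsLYA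
import Summits.CriticalPhenomena.PercolationContinuityZ3.Theorems.Transplant.SkelFrmBParamsFaceFloorsQYA
import Summits.CriticalPhenomena.PercolationContinuityZ3.Theorems.Transplant.SkelFrmBParamsFaceFloorsZPiYA
import Summits.CriticalPhenomena.PercolationContinuityZ3.Theorems.Transplant.SkelFrmBParamsFaceFloorsZYA
import Summits.CriticalPhenomena.PercolationContinuityZ3.Theorems.Transplant.SkelFrmBParamsFaceFloorsPinYA
import Summits.CriticalPhenomena.PercolationContinuityZ3.Theorems.Transplant.SkelFrmBParamsFaceCountsYA
import Summits.CriticalPhenomena.PercolationContinuityZ3.Theorems.Transplant.SkelFrmBParamsFaceCountsRangeYA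
import Summits.CriticalPhenomena.PercolationContinuityZ3.Theorems.Transplant.SkelFrmBParamsFaceCountsShiftYA
import Summits.CriticalPhenomena.PercolationContinuityZ3.Theorems.Transplant.SkelPhiFaceNumsYP2T
import Summits.CriticalPhenomena.PercolationContinuityZ3.Theorems.Transplant.SkelFrmBChoiceWindow
import Summits.CriticalPhenomena.PercolationContinuityZ3.Theorems.Transplant.PlanarSkeletonFrmDefs
import Summits.CriticalPhenomena.PercolationContinuityZ3.Theorems.Transplant.SkelPhiStepIDataNS
import Summits.CriticalPhenomena.PercolationContinuityZ3.Theorems.Transplant.SkelFrmBParamsFaceFloorsY2SA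
import Summits.CriticalPhenomena.PercolationContinuityZ3.Theorems.Transplant.SkelFrmBParamsFaceFloorsY2WA
import Summits.CriticalPhenomena.PercolationContinuityZ3.Theorems.Transplant.SkelFrmBParamsFaceFloorsYxC
import Summits.CriticalPhenomena.PercolationContinuityZ3.Theorems.Transplant.SkelFrmBParamsFaceFloorsLXA
import Summits.CriticalPhenomena.PercolationContinuityZ3.Theorems.Transplant.SkelFrmBParamsFaceFloorsX2WA
import Summits.CriticalPhenomena.PercolationContinuityZ3.Theorems.Transplant.SkelFrmBParamsFaceFloorsClrXA
import HarnessLib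
/-!
# N2 (frames-only node, OPEN) — (F) column, (R-49)(c2b) VALUE LAYER part D: **THE TARGET ROWS OF THE X4-SHAPED y′-FACE ROUTE** (hp-8 g43)

The y′-run's last core `N₃ + 1` (from the junction `yT`) must lie in the arrival box `cenS (x+du) ± (small3 − 2)`: the four rows `FL1–FL4` of
`Skelφ.FloorsYx2V`. LEVEL (coordinate 1): the x-face chain's `KS.FL3_XW / FL4_XW` (SkelFrmBParamsFaceFloorsX2WA; generic in origin, sign,
count and core index; second-run window `qB3XA`) serve verbatim once the landing is within `T1Y ± bwX` — `KS.juncYx_levelwin` gives exactly that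
from `NrY_spec` at the junction (`F1cA yT = F1cA (yTX0 yL σ)`, `|F1cA (yTX0 yL σ) − F1cA yL| ≤ 2`: landing within `±(u₁ + 2) ⊂ ±bwX = ±13u₁`).
ABSCISSA (coordinate 0): `KS.FL1_Yx / FL2_Yx` — generic in the junction reading `F := FcA yT`: inside `T0Y ± (small3 0 − 2)` from
`T0Y − small3 0 + 6u₀ + 3 ≤ F` / `F + 6u₀ + 3 ≤ T0Y + small3 0` and the x-face chain's core envelope `yBndC_env` (`yBndC (N₃+1) + 2n ≤ 6·n·m`);
`KS.juncYx_window` supplies the two premises at the node: `FcA yT ∈ [T0Y − bwY, max (T0Y + bwY) (FcA yL + 7u₀ + 2)]` (`N3WY_spec` at the prefix's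
start reading `yTX0 yL σ`, `N_x = max 6 N3WY`), `bwY = small3 0 − 7u₀`, and the start row `12u₀ + 5 ≤ T0Y + bwY`.
NON-VACUITY: instantiated by part E at the node tuple. builds on p205010 (kernel theorem, internal audit signed; external expert review pending) —
nothing here uses p205010; NOTHING is claimed about the open node `SamePDropOfSkeletonFrm₁`.
Lane `prim-bschramm`, seat `prim-hp-8` (gen 43); helper file (`--supports stmt-CriticalPhenomena-4575 --as helper`).
[cite: KozmaNitzan2024, §4 Lemma 11–12 (pp. 21–25)] [cite: MartineauTassion2017, §4.3]
-/

noncomputable section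

open scoped Classical

namespace Summit.CriticalPhenomena.PercolationContinuityZ3.Theorems.Transplant

namespace PlanarSkeletonFrm

namespace NegB

open Literature.Probability.Percolation Literature.Probability.LatticeModels SimpleGraph KNCells KNLevels
open Literature.Probability.Percolation.KozmaNitzan.Cells (oth sgOf sgOf_sign stepVec_apply_fst)
open SkelConc (Consts)
open Skelφ (shearUnit shearUnit_pos yBoxLoS yBoxHiS ySLo ySHi yBnd yBndC xBoxB xSLo xSHi xBoxLoA xBoxHiA crossOffY crossOffX yPrmW xCoreB xCSLo xCSHi)
open Skelφ.StepI (DataN)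
open ChainPlanar (BridgePrm)
open TwoAxis.Para (modulus)
open Neg

namespace KS

/-- **`FL1` of the X4-shaped route, generic**: if the junction reading clears the box's near edge by `6u₀ + 3` (`T0Y − small3 0 + 6u₀ + 3 ≤ F`),
the last core's lower abscissa end is inside the arrival box (`yBndC_env`: core half-width `≤ 6u₀`). [cite: KozmaNitzan2024, §4 Lemma 12 (pp. 23–25)] -/
theorem FL1_Yx (κ : Consts) {V : Type} [DecidableEq V] [Countable V] {G : SimpleGraph V} [G.LocallyFinite] (Φ : PlanarSkeletonFrm G) (t : V) (p : unitInterval) (D : Skelφ.StepI.DataNS V) (g : ℕ) (f : ℕ) (mk : ℕ) (P : PCells2T) (hN : EqNumL κ Φ t p D g f) (hκ : (hL κ Φ t p D g f).natAbs ≤ 10 * nL κ Φ t p D g f) (x : Site 2) (du : MDir) (z yT : Site 2)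
    {N₃ : ℕ} (hk : (((N₃ + 1 : ℕ) : ℤ)) * ((KS0.R'0 κ Φ t p D mk) : ℤ) ≤ nL κ Φ t p D g f)
    (hℓ : 11 * (2 * ((N₃ + 1 : ℕ) : ℤ) + (((N₃ + 1 : ℕ) : ℤ) + 1000 * Neg.Kq κ) * ((KS0.R'0 κ Φ t p D mk) : ℤ) + 8) ≤ 2 * (ℓL κ Φ t p D g f : ℤ))
    (hF : T0Y P x du z - ((NegB.BSlot.small3 κ Φ t p D g f 0 : ℕ) : ℤ) + 6 * u₀A κ Φ t p D g f + 3 ≤ FcA κ Φ t p D g f yT) :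
    (nL κ Φ t p D g f : ℤ) * modulus (nL κ Φ t p D g f) (hL κ Φ t p D g f) (vL κ Φ t p D g f) (vβL κ Φ t p D g f) *
        (P.cenS (x + stepVec du) 0 - ((NegB.BSlot.small3 κ Φ t p D g f 0 : ℕ) : ℤ) + 2 - z 0 - FcA κ Φ t p D g f yT) ≤
      -(u₀A κ Φ t p D g f * (yBndC (nL κ Φ t p D g f) (hL κ Φ t p D g f) (modulus (nL κ Φ t p D g f) (hL κ Φ t p D g f) (vL κ Φ t p D g f) (vβL κ Φ t p D g f)) (qB3XA κ Φ t p D g f (KS0.R'0 κ Φ t p D mk)) (KS0.R'0 κ Φ t p D mk) (N₃ + 1) + 2 * (nL κ Φ t p D g f : ℤ))) -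
        (nL κ Φ t p D g f : ℤ) * modulus (nL κ Φ t p D g f) (hL κ Φ t p D g f) (vL κ Φ t p D g f) (vβL κ Φ t p D g f) := by
  obtain ⟨hn1, hℓ1⟩ := one_le_of_eqNumL κ Φ t p D g f hN
  have hm0 : 0 < modulus (nL κ Φ t p D g f) (hL κ Φ t p D g f) (vL κ Φ t p D g f) (vβL κ Φ t p D g f) := Skelφ.NegPrm.modulus_vβOf_pos hn1 hℓ1 _ _
  have henv := yBndC_env κ Φ t p D g f mk hN hκ hk hℓ
  have hu : 1 ≤ u₀A κ Φ t p D g f := (units_eqA κ Φ t p D g f).2.2.2.2.1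
  have hn1' : (1 : ℤ) ≤ (nL κ Φ t p D g f : ℤ) := by exact_mod_cast hn1
  have hT : T0Y P x du z = P.cenS (x + stepVec du) 0 - z 0 := rfl
  set n : ℤ := (nL κ Φ t p D g f : ℤ)
  set m := modulus (nL κ Φ t p D g f) (hL κ Φ t p D g f) (vL κ Φ t p D g f) (vβL κ Φ t p D g f)
  set u := u₀A κ Φ t p D g f
  set F := FcA κ Φ t p D g f yT
  set b : ℤ := ((NegB.BSlot.small3 κ Φ t p D g f 0 : ℕ) : ℤ)
  set Bc := yBndC (nL κ Φ t p D g f) (hL κ Φ t p D g f) m (qB3XA κ Φ t p D g f (KS0.R'0 κ Φ t p D mk)) (KS0.R'0 κ Φ t p D mk) (N₃ + 1)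
  have e : P.cenS (x + stepVec du) 0 - b + 2 - z 0 - F = T0Y P x du z - b + 2 - F := by rw [hT]; ring
  rw [e]
  have hnm : 0 < n * m := mul_pos (by linarith) hm0
  have hBn : u * (Bc + 2 * n) ≤ u * (6 * n * m) := mul_le_mul_of_nonneg_left henv (by linarith)
  have key : n * m * (T0Y P x du z - b + 2 - F) + u * (6 * n * m) + n * m ≤ 0 := by
    have : n * m * (T0Y P x du z - b + 2 - F + 6 * u + 1) ≤ n * m * 0 := mul_le_mul_of_nonneg_left (by linarith) hnm.le
    linarith
  linarith

/-- **`FL2` of the X4-shaped route, generic**: if the junction reading stays `6u₀ + 3` inside the box's far edge (`F + 6u₀ + 3 ≤ T0Y + small3 0`),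
the last core's upper abscissa end is inside the arrival box. [cite: KozmaNitzan2024, §4 Lemma 12 (pp. 23–25)] -/
theorem FL2_Yx (κ : Consts) {V : Type} [DecidableEq V] [Countable V] {G : SimpleGraph V} [G.LocallyFinite] (Φ : PlanarSkeletonFrm G) (t : V) (p : unitInterval) (D : Skelφ.StepI.DataNS V) (g : ℕ) (f : ℕ) (mk : ℕ) (P : PCells2T) (hN : EqNumL κ Φ t p D g f) (hκ : (hL κ Φ t p D g f).natAbs ≤ 10 * nL κ Φ t p D g f) (x : Site 2) (du : MDir) (z yT : Site 2)
    {N₃ : ℕ} (hk : (((N₃ + 1 : ℕ) : ℤ)) * ((KS0.R'0 κ Φ t p D mk) : ℤ) ≤ nL κ Φ t p D g f)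
    (hℓ : 11 * (2 * ((N₃ + 1 : ℕ) : ℤ) + (((N₃ + 1 : ℕ) : ℤ) + 1000 * Neg.Kq κ) * ((KS0.R'0 κ Φ t p D mk) : ℤ) + 8) ≤ 2 * (ℓL κ Φ t p D g f : ℤ))
    (hF : FcA κ Φ t p D g f yT + 6 * u₀A κ Φ t p D g f + 3 ≤ T0Y P x du z + ((NegB.BSlot.small3 κ Φ t p D g f 0 : ℕ) : ℤ)) :
    (nL κ Φ t p D g f : ℤ) * modulus (nL κ Φ t p D g f) (hL κ Φ t p D g f) (vL κ Φ t p D g f) (vβL κ Φ t p D g f) * (FcA κ Φ t p D g f yT + 1) +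
        u₀A κ Φ t p D g f * (yBndC (nL κ Φ t p D g f) (hL κ Φ t p D g f) (modulus (nL κ Φ t p D g f) (hL κ Φ t p D g f) (vL κ Φ t p D g f) (vβL κ Φ t p D g f)) (qB3XA κ Φ t p D g f (KS0.R'0 κ Φ t p D mk)) (KS0.R'0 κ Φ t p D mk) (N₃ + 1) + nL κ Φ t p D g f) ≤
      (nL κ Φ t p D g f : ℤ) * modulus (nL κ Φ t p D g f) (hL κ Φ t p D g f) (vL κ Φ t p D g f) (vβL κ Φ t p D g f) * (P.cenS (x + stepVec du) 0 + ((NegB.BSlot.small3 κ Φ t p D g f 0 : ℕ) : ℤ) - 2 - z 0) := by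
  obtain ⟨hn1, hℓ1⟩ := one_le_of_eqNumL κ Φ t p D g f hN
  have hm0 : 0 < modulus (nL κ Φ t p D g f) (hL κ Φ t p D g f) (vL κ Φ t p D g f) (vβL κ Φ t p D g f) := Skelφ.NegPrm.modulus_vβOf_pos hn1 hℓ1 _ _
  have henv := yBndC_env κ Φ t p D g f mk hN hκ hk hℓ
  have hu : 1 ≤ u₀A κ Φ t p D g f := (units_eqA κ Φ t p D g f).2.2.2.2.1
  have hn1' : (1 : ℤ) ≤ (nL κ Φ t p D g f : ℤ) := by exact_mod_cast hn1
  have hT : T0Y P x du z = P.cenS (x + stepVec du) 0 - z 0 := rfl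
  set n : ℤ := (nL κ Φ t p D g f : ℤ)
  set m := modulus (nL κ Φ t p D g f) (hL κ Φ t p D g f) (vL κ Φ t p D g f) (vβL κ Φ t p D g f)
  set u := u₀A κ Φ t p D g f
  set F := FcA κ Φ t p D g f yT
  set b : ℤ := ((NegB.BSlot.small3 κ Φ t p D g f 0 : ℕ) : ℤ)
  set Bc := yBndC (nL κ Φ t p D g f) (hL κ Φ t p D g f) m (qB3XA κ Φ t p D g f (KS0.R'0 κ Φ t p D mk)) (KS0.R'0 κ Φ t p D mk) (N₃ + 1)
  have e : P.cenS (x + stepVec du) 0 + b - 2 - z 0 = T0Y P x du z + b - 2 := by rw [hT]; ring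
  rw [e]
  have hnm : 0 < n * m := mul_pos (by linarith) hm0
  have hBn : u * (Bc + n) ≤ u * (6 * n * m) := mul_le_mul_of_nonneg_left (by linarith) (by linarith)
  have key : n * m * (F + 1) + u * (6 * n * m) ≤ n * m * (T0Y P x du z + b - 2) := by
    have : n * m * (F + 1 + 6 * u) ≤ n * m * (T0Y P x du z + b - 2) := mul_le_mul_of_nonneg_left (by linarith) hnm.le
    linarith
  linarith

/-- **The junction's abscissa is inside the corrector window** (one-sided): `T0Y − bwY ≤ FcA yT` and `FcA yT + 6u₀ + 3 ≤ T0Y + small3 0`, from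
`N3WY_spec` at the prefix's start reading `yTX0 yL σ` (`N_x = max 6 N3WY`: the forced strides only move the junction further in, and are
covered by the start row `12u₀ + 5 ≤ T0Y + bwY` when `N3WY < 6`), `bwY = small3 0 − 7u₀`, `|FcA (yTX0 yL σ) − FcA yL| ≤ u₀ + 2`, `|FcA yL| ≤ 5u₀`. [folklore] -/
theorem juncYx_window (κ : Consts) {V : Type} [DecidableEq V] [Countable V] {G : SimpleGraph V} [G.LocallyFinite] (Φ : PlanarSkeletonFrm G) (t : V) (p : unitInterval) (D : Skelφ.StepI.DataNS V) (g : ℕ) (f : ℕ) (hN : EqNumL κ Φ t p D g f) (P : PCells2T) (x : Site 2) (du : MDir) (hsg : sgOf du = 1) (z yL : Site 2)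
    (he : |FcA κ Φ t p D g f yL| ≤ 5 * u₀A κ Φ t p D g f) (hu11 : 11 ≤ u₀A κ Φ t p D g f) (hTw : 12 * u₀A κ Φ t p D g f + 5 ≤ T0Y P x du z + (bwY κ Φ t p D g f : ℤ)) :
    T0Y P x du z - (bwY κ Φ t p D g f : ℤ) ≤ FcA κ Φ t p D g f (yTYx κ Φ t p D g f P yL x du z (bwY κ Φ t p D g f)) ∧
      FcA κ Φ t p D g f (yTYx κ Φ t p D g f P yL x du z (bwY κ Φ t p D g f)) + 6 * u₀A κ Φ t p D g f + 3 ≤ T0Y P x du z + ((NegB.BSlot.small3 κ Φ t p D g f 0 : ℕ) : ℤ) := by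
  obtain ⟨eF, hdx⟩ := juncYx_FcA κ Φ t p D g f hN P yL x du z (bwY κ Φ t p D g f)
  have eσ : sgOf du * u₀A κ Φ t p D g f * ((NxW κ Φ t p D g f P yL x du z (bwY κ Φ t p D g f) : ℤ) + 1) = u₀A κ Φ t p D g f * ((NxW κ Φ t p D g f P yL x du z (bwY κ Φ t p D g f) : ℤ) + 1) := by
    rw [hsg, one_mul]
  rw [eF, eσ]
  obtain ⟨hbw, hbw2⟩ := bwY_eq κ Φ t p D g f
  have hu : 1 ≤ u₀A κ Φ t p D g f := (units_eqA κ Φ t p D g f).2.2.2.2.1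
  obtain ⟨e1, e2⟩ := abs_le.1 he
  obtain ⟨x1, x2⟩ := abs_le.1 hdx
  set u := u₀A κ Φ t p D g f with hu_def
  set F0 := FcA κ Φ t p D g f (yTX0 κ Φ t p D g f yL (sgOf du))
  have hF : F0 + u ≤ T0Y P x du z + (bwY κ Φ t p D g f : ℤ) := by linarith
  obtain ⟨-, hWlo, hWhi⟩ := N3WY_spec κ Φ t p D g f P (yTX0 κ Φ t p D g f yL (sgOf du)) x du z hbw2 hF
  rw [one_mul] at hWlo hWhi
  -- `N_x = max 6 N`
  have hNx : ((NxW κ Φ t p D g f P yL x du z (bwY κ Φ t p D g f) : ℤ) = 6 ∧ ((N3WY κ Φ t p D g f P (yTX0 κ Φ t p D g f yL (sgOf du)) x du z (bwY κ Φ t p D g f) : ℕ) : ℤ) ≤ 6) ∨ (NxW κ Φ t p D g f P yL x du z (bwY κ Φ t p D g f) : ℤ) = ((N3WY κ Φ t p D g f P (yTX0 κ Φ t p D g f yL (sgOf du)) x du z (bwY κ Φ t p D g f) : ℕ) : ℤ) := by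
    unfold NxW NX0
    rcases le_total 6 (N3WY κ Φ t p D g f P (yTX0 κ Φ t p D g f yL (sgOf du)) x du z (bwY κ Φ t p D g f)) with h | h
    · right; rw [max_eq_right h]
    · left; rw [max_eq_left h]; exact ⟨by norm_num, by exact_mod_cast h⟩
  have hu3 : 3 ≤ u := by
    have := (units_eqA κ Φ t p D g f).2.2.2.2.1; linarith [hu11]
  rcases hNx with ⟨h5, hN5⟩ | hNN
  · rw [h5]
    have : u * ((N3WY κ Φ t p D g f P (yTX0 κ Φ t p D g f yL (sgOf du)) x du z (bwY κ Φ t p D g f) : ℕ) : ℤ) ≤ u * 6 := mul_le_mul_of_nonneg_left hN5 (by linarith)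
    have hN0 : (0 : ℤ) ≤ ((N3WY κ Φ t p D g f P (yTX0 κ Φ t p D g f yL (sgOf du)) x du z (bwY κ Φ t p D g f) : ℕ) : ℤ) := by positivity
    constructor <;> nlinarith
  · rw [hNN]
    constructor <;> linarith

/-- **The landing level is inside the x-face corrector's level window** (the `hNT` premises of `FL3_XW/FL4_XW` at the junction): with the along
count `N_y := NrY` read at the junction `yT` (`F1cA yT = F1cA (yTX0 yL σ)`), `T1Y − bwX ≤ F1cA yL + u₁·(N_y + 1) ≤ T1Y + bwX` one-sided
(`NrY_spec`: landing within `u₁`; `|F1cA (yTX0 yL σ) − F1cA yL| ≤ 2`; `bwX = small3 1 − 6u₁ ≥ u₁ + 2`). [folklore] -/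
theorem juncYx_levelwin (κ : Consts) {V : Type} [DecidableEq V] [Countable V] {G : SimpleGraph V} [G.LocallyFinite] (Φ : PlanarSkeletonFrm G) (t : V) (p : unitInterval) (D : Skelφ.StepI.DataNS V) (g : ℕ) (f : ℕ) (hN : EqNumL κ Φ t p D g f) (P : PCells2T) (x : Site 2) (du : MDir) (hsg : sgOf du = 1) (z yL : Site 2) (bw : ℕ)
    (hX : u₁A κ Φ t p D g f ≤ sgOf du * (T1Y P x du z - F1cA κ Φ t p D g f (yTYx κ Φ t p D g f P yL x du z bw))) (hu3 : 3 ≤ u₁A κ Φ t p D g f) :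
    T1X P x du z - (bwX κ Φ t p D g f : ℤ) ≤ F1cA κ Φ t p D g f yL + 1 * u₁A κ Φ t p D g f * (((NrY κ Φ t p D g f P (yTYx κ Φ t p D g f P yL x du z bw) x du z + 1 : ℕ) : ℤ)) ∧
      F1cA κ Φ t p D g f yL + 1 * u₁A κ Φ t p D g f * (((NrY κ Φ t p D g f P (yTYx κ Φ t p D g f P yL x du z bw) x du z + 1 : ℕ) : ℤ)) ≤ T1X P x du z + (bwX κ Φ t p D g f : ℤ) := by
  have hT : T1X P x du z = T1Y P x du z := rfl
  obtain ⟨eF1, -⟩ := juncYx_F1cA κ Φ t p D g f hN P yL x du z bw (le_refl |F1cA κ Φ t p D g f yL|)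
  have hsh := F1cA_yTX0_sub_abs_le κ Φ t p D g f hN yL (sgOf du)
  obtain ⟨hsp, -⟩ := NrY_spec κ Φ t p D g f P (yTYx κ Φ t p D g f P yL x du z bw) x du z hX
  rw [hsg, one_mul] at hsp
  rw [eF1] at hsp
  obtain ⟨s1, s2⟩ := abs_le.1 hsh
  obtain ⟨p1, p2⟩ := abs_le.1 hsp
  have hb := (bwX_eq κ Φ t p D g f).1
  have hb3 := (NegB.small3_eq κ Φ t p D g f).2
  have eb : (bwX κ Φ t p D g f : ℤ) = 13 * u₁A κ Φ t p D g f := by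
    rw [hb, hb3]; unfold u₁A; push_cast; ring
  rw [hT, eb]; push_cast
  constructor <;> linarith

end KS

end NegB

end PlanarSkeletonFrm

end Summit.CriticalPhenomena.PercolationContinuityZ3.Theorems.Transplant

end
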